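import Summits.BirchSwinnertonDyer.Rank1Residual.Supersingular.KobayashiMainConjecture
import Summits.BirchSwinnertonDyer.Rank1Residual.Supersingular.GoodSSTowerOfSurj
import Summits.BirchSwinnertonDyer.Rank1Residual.X9.SurjBigImage
import Literature.NumberTheory.EllipticCurves.Kobayashi2003.SignedKatoDivisibility
import Literature.NumberTheory.EllipticCurves.Sprung2024.ChromaticRankZeroOneSided
import Literature.NumberTheory.EllipticCurves.ComplexMultiplicationNotSemistable
import Literature.NumberTheory.DiophantineGeometry.PastenValuationProductsProofs
import HarnessLib

/-!
# Leaf `ClassX6 ∧ r_an = 0` — the DISCHARGE INTERFACE: leaf predicate ⟹ the printed hypotheses of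
# every theorem the print route cites (cell `bsd-print-x6`, typer seat `ty2`; D-0131 (2) print tier)

HONEST FRAMING (cell `bsd-print-x6`, run/shared/lean/pub/bsd-print-x6/README.md): the cell closes the
partition leaf `ClassX6 W p ∧ W.analyticRank = 0` (good supersingular odd `p`, `E` semistable,
`p ≥ 5 ∨ a_3 = 0`; `Partition/CornersAll.lean`, hypothesis `¬ (ClassX6 W p ∧ W.analyticRank = 0)`;
ladder row K3/A6) BY NAME from the cited theorems typed exactly. THIS FILE asserts nothing about any
curve and introduces NO definition and NO named fact (debt 0): it is the sorry-free map
"leaf predicate ⟹ hypotheses", i.e. for every hypothesis that a cited theorem PRINTS — in every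
spelling the tree uses for it — a theorem deriving it from `(hp : p ≠ 2) (hX : ClassX6 W p)` (and
`h0 : W.analyticRank = 0` where the rank enters), plus the by-name APPLICATION of each typed theorem on
the leaf with all class-level hypotheses discharged, so that the provers' closing files are one-liners.

## The dictionary (printed hypothesis ⟶ tree spelling ⟶ lemma here or already in the tree)

| printed | tree spelling | discharge |
|---|---|---|
| "`p > 2`", "`p` odd" | `p ≠ 2` | the leaf's own binder `hp` (`Nat.Prime.odd_of_ne_two`, `Nat.Prime.five_le_of_ne_two_of_ne_three`) |
| "`p ≥ 5` or (`p = 3` and `a_3 = 0`)" | `5 ≤ p ∨ (p = 3 ∧ a_3 = 0)` | `ClassX6.five_le_or_eq_three` |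
| "good reduction at `p`", "`p ∤ N`" | `Good W p` = `W.HasGoodReductionAtPrime p` | `ClassX6.good` |
| "supersingular at `p`" | `GoodSS W p` (`p ∣ a_p`); `p ∈ W.goodSupersingularPrimes` | `ClassX6.goodSS`, `ClassX6.natCast_dvd_frobeniusTrace`, `ClassX6.mem_goodSupersingularPrimes` |
| "`a_p = 0`" (Kobayashi 2003, Pollack 2003, B. D. Kim 2013, BSTW (1.7)) | `W.frobeniusTrace p = 0` | `ClassX6.frobeniusTrace_eq_zero` (tree, `KobayashiMainConjecture.lean`) |
| "(1.7) if `p = 3`" (BSTW Thm. 1.3/1.5) | `p = 3 → W.frobeniusTrace 3 = 0` | `BurungaleSkinnerTianWan2024.h4_of_classX6` (tree); packaged: `ClassX6.bstw_hyps` |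
| "not additive at `p`" (Wuthrich 2014 Prop. 21) | `¬ ((W.baseChange ℚ_[p]).minimal ℤ_[p]).HasAdditiveReduction ℤ_[p]` | `ClassX6.not_hasAdditiveReduction` |
| "not ordinary / not multiplicative / not additive at `p`" | `¬ GoodOrd`, `¬ Mult`, `¬ Addv` | `ClassX6.not_goodOrd`, `ClassX6.not_mult`, `ClassX6.not_addv` |
| "`E` semistable", "`N` square-free" | `Semistable W`; `W.IsSemistable ℤ`; `W.IsSemistable (𝓞 ℚ)` (JSW 2017, Sprung 2024); `Squarefree (W.conductorNorm ℤ)` | `ClassX6.semistable`, `ClassX6.isSemistable_int`, `ClassX6.isSemistable_ringOfIntegers`, `ClassX6.squarefree_conductorNorm`, `ClassX6.good_or_mult` |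
| "`E` without CM" (Kobayashi Thm. 1.3, Serre) | `¬ W.HasCM` | `ClassX6.not_hasCM` (tree, `ComplexMultiplicationNotSemistable.lean`) |
| "`E[p]` irreducible", "no rational `p`-isogeny" | `Irr W p`; `¬ Red W p`; `¬ Anom W p` | `ClassX6.irr`, `ClassX6.not_red` (tree, `Typed/X6.lean`), `ClassX6.not_anom` |
| "`ρ̄_{E,p}` surjective" (Kato (12.5.2) residual form, Wuthrich "reducible or surjective") | `Surj W p`; `¬ Irr ∨ Surj` | `ClassX6.surj` (tree), `ClassX6.not_irr_or_surj` |
| "`ρ_{E,p^∞} : G_ℚ ↠ GL₂(ℤ_p)`" (Kobayashi Thm. 4.1 "`n = 0`", Kato 17.4 (3)) | `∀ n, W.HasSurjectiveModNGaloisRep (p ^ n)`; `Kato2004.ImageContainsSL2 W p` | `ClassX6.towerSurj`, `ClassX6.imageContainsSL2` (tree, `GoodSSTowerOfSurj.lean`, `RankZeroUpperBoundProp48.lean`) |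
| "(im)" (BCS 2025 / Yan–Zhu (Im)) | `BigIm W p` | `ClassX6.bigIm` |
| "`p ∤ #E(ℚ)_tors`" (Sprung 2024 p. 41; print shapes without torsion term) | `padicValNat p W.torsionOrder = 0`; `¬ p ∣ W.torsionOrder` | `ClassX6.padicValNat_torsionOrder_eq_zero`, `ClassX6.not_dvd_torsionOrder` |
| "`L(E,1) ≠ 0`", "`ord_{s=1} L(E,s) = 0`" | `W.analyticRank = 0`; `W.entireLFunction 1 ≠ 0` | the leaf's binder `h0`; `(W.analyticRank_eq_zero_iff_holds (hmod W)).1 h0` (modularity `hmod : hasEntireLFunction_rat`) |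
| "`E(ℚ)` finite, `Ш` finite" (presupposed by every printed `#Ш`) | `W.mordellWeilRank = W.analyticRank ∧ Finite W.sha` | GZK named fact `rank_eq_analyticRank_of_analyticRank_le_one W (r_an ≤ 1)` |

## By-name applications on the leaf (every class-level hypothesis discharged here)

* Burungale–Skinner–Tian–Wan 2024 Thm. 1.3 (typed `BurungaleSkinnerTianWan2024_thm13_OPEN`):
  `X6.kobayashiMainConjecture_of_thm13_OPEN`, `X6.kobayashiLowerDivisibility_of_thm13_OPEN`; Thm. 1.5
  (typed `BurungaleSkinnerTianWan2024.thm15_pPart_OPEN`): `X6.printShape_of_thm15_OPEN`. The rank-`0`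
  closures `X6.bsdp_of_BSTW13_OPEN_of_analyticRank_eq_zero` / `X6.bsdp_of_thm15_OPEN'` are ALREADY tree
  theorems (`KobayashiMainConjecture.lean`, `SupersingularPPartOPEN.lean`).
* Kobayashi 2003 Thm. 1.2 / Thm. 4.1 (`thm12_…`, `thm41_…`) and Pollack 2003 (`pollack_exists_…`):
  `X6.signedSelmerDual_finite_isTorsion`, `X6.signedPAdicLFunction_mem_charIdeal` (the INTEGRAL
  Kato-side inclusion `L_p^ε ∈ Char X^ε`, image hypothesis discharged by `ClassX6.towerSurj`),
  `X6.signedPAdicLFunction_mem_charIdeal_of_thm12`, `X6.exists_isPollackPair`.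
* Wuthrich 2014 Prop. 21 (`sha_dvd_analyticSha`) and Sprung 2024 Cor. 1.2 (ii)
  (`Sprung2024.cor12_padicValRat_bsd_rank_zero_le`): the rank-`0` UPPER bound `ord_p #Ш ≤ ord_p #Ш_an`
  on the leaf with NO further hypothesis — `X6RankZero.missingUpperBoundAt_of_wuthrich`,
  `X6RankZero.missingUpperBoundAt_of_sprungCor12` — and the UNIT-VALUE cells (`ord_p #Ш_an ≤ 0`) closed
  outright: `X6RankZero.bsdp_of_wuthrich_of_shaAn_le`, `X6RankZero.bsdp_of_sprungCor12_of_shaAn_le`.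
  The LOWER-bound road `X6.bsdp_of_missingLowerBoundAt_of_analyticRank_eq_zero` is a tree theorem
  (`Typed/X6.lean`).
* Castella–Wan 2024 Thm. A: `CastellaWan2024.thmA_hyps_of_classX6` (tree); CCSS 2018 Thm. C/D:
  `X6.bsdp_of_thmCD_OPEN'` (tree); descent road: `X6.bsdp_rankZero_of_casselsTate_of_selmerGroup_ne_bot`
  etc. (tree, `DescentLowerBound*.lean`) — all take `ClassX6 W p` directly.

References: `Literature/NumberTheory/EllipticCurves/Rank1Residual/Predicates.lean` (the predicates);
[BurungaleSkinnerTianWan2024] Thm. 1.3, Thm. 1.5, (1.7); [Kobayashi2003] Thm. 1.2, Thm. 4.1; [Pollack2003]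
Thm. 5.6; [Wuthrich2014] Lemma 20, Prop. 21; [Sprung2024] Cor. 1.2; [Serre1972] §1.11 Prop. 12, §5.4
Prop. 21 i); [SilvermanAEC2009] VII.5; [Mazur1977] III §5; [Miller2011LMS] Def. 1.1.
-/

set_option autoImplicit false

noncomputable section

open scoped Classical NumberField MatrixGroups ModularForm

open CongruenceSubgroup WeierstrassCurve Literature.NumberTheory.EllipticCurves
  Literature.NumberTheory.EllipticCurves.ModularForms
  Literature.NumberTheory.EllipticCurves.Rank1Residual
  Literature.NumberTheory.EllipticCurves.Rank1Residual.Typed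
  Literature.NumberTheory.EllipticCurves.Wuthrich2014
  Literature.NumberTheory.EllipticCurves.Kobayashi2003 ZpExtension

namespace Summit.BirchSwinnertonDyer.Rank1Residual.Supersingular

/-! ### §1 Class-level hypotheses that need no ellipticity instance -/

section ClassLevel

variable (W : WeierstrassCurve ℚ) [W.IsGloballyMinimal] (p : ℕ) [Fact p.Prime]

/-- "`p` is a prime of good reduction" (`p ∤ N`): the first conjunct of `ss(p)`. [folklore] -/
theorem ClassX6.good (hX : ClassX6 W p) : Good W p := hX.1.1

/-- "`p` is a good supersingular prime" in the census spelling `GoodSS W p` (`p ∤ N ∧ p ∣ a_p`). [folklore] -/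
theorem ClassX6.goodSS (hX : ClassX6 W p) : GoodSS W p := hX.1

/-- "supersingular": `p ∣ a_p` (on the globally minimal model, `a_p = W.frobeniusTrace p`). [folklore] -/
theorem ClassX6.natCast_dvd_frobeniusTrace (hX : ClassX6 W p) : (p : ℤ) ∣ W.frobeniusTrace p := hX.1.2

/-- "supersingular" in the spelling of `SupersingularDensity.lean`: `p ∈ W.goodSupersingularPrimes`.
[cite: Serre1981, §8] -/
theorem ClassX6.mem_goodSupersingularPrimes (hX : ClassX6 W p) : p ∈ W.goodSupersingularPrimes :=
  ⟨inferInstance, hX.1.1, hX.1.2⟩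

/-- "`E` is semistable" in the census spelling (good or multiplicative at every prime). [folklore] -/
theorem ClassX6.semistable (hX : ClassX6 W p) : Semistable W := hX.2.1

/-- The class side condition as printed in RESIDUAL-CASES §a.2: `p ≥ 5 ∨ a_3 = 0`. [folklore] -/
theorem ClassX6.five_le_or_frobeniusTrace_three_eq_zero (hX : ClassX6 W p) :
    5 ≤ p ∨ W.frobeniusTrace 3 = 0 := hX.2.2

/-- At an ODD prime the class splits as "`p ≥ 5`" or "`p = 3` with `a_3 = 0`" — the two printed
regimes (Kobayashi 2003 "`a_p = 0` (e.g. `p ≥ 5`)"; BSTW "(1.7) … only an extra condition when `p = 3`").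
[cite: Kobayashi2003, Conjecture (p. 2)] -/
theorem ClassX6.five_le_or_eq_three (hp : p ≠ 2) (hX : ClassX6 W p) :
    5 ≤ p ∨ (p = 3 ∧ W.frobeniusTrace 3 = 0) := by
  by_cases h3 : p = 3
  · subst h3
    rcases hX.2.2 with h5 | h0
    · omega
    · exact Or.inr ⟨rfl, h0⟩
  · exact Or.inl ((Fact.out : p.Prime).five_le_of_ne_two_of_ne_three hp h3)

/-- "not additive at `p`" in the LOCAL spelling of Wuthrich 2014 Prop. 21 (`sha_dvd_analyticSha`,
`Typed.missingUpperBoundAt_of_wuthrich`): the `ℤ_p`-minimal model of `E/ℚ_p` is not additive, because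
it has good reduction. [cite: SilvermanAEC2009, VII.5 Prop. 5.1] -/
theorem ClassX6.not_hasAdditiveReduction (hX : ClassX6 W p) :
    ¬ ((W.baseChange ℚ_[p]).minimal ℤ_[p]).HasAdditiveReduction ℤ_[p] :=
  WeierstrassCurve.HasGoodReduction.not_hasAdditiveReduction (R := ℤ_[p]) hX.1.1

/-- Good reduction at `p` excludes multiplicative reduction at `p`. [cite: SilvermanAEC2009, VII.5 Prop. 5.1] -/
theorem ClassX6.not_mult (hX : ClassX6 W p) : ¬ Mult W p :=
  fun h ↦ WeierstrassCurve.HasMultiplicativeReduction.not_hasGoodReduction (R := ℤ_[p]) h hX.1.1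

/-- Good reduction at `p` excludes additive reduction at `p` (census spelling `Addv`). [cite: SilvermanAEC2009, VII.5 Prop. 5.1] -/
theorem ClassX6.not_addv (hX : ClassX6 W p) : ¬ Addv W p := fun h ↦ h.1 hX.1.1

/-- A supersingular prime is not a good ORDINARY prime (`ord(p) = good ∧ p ∤ a_p`). [folklore] -/
theorem ClassX6.not_goodOrd (hX : ClassX6 W p) : ¬ GoodOrd W p := fun h ↦ h.2 hX.1.2

/-- `p ∣ a_p` excludes the anomalous congruence `a_p ≡ 1 (mod p)`. [folklore] -/
theorem ClassX6.not_dvd_frobeniusTrace_sub_one (hX : ClassX6 W p) :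
    ¬ (p : ℤ) ∣ W.frobeniusTrace p - 1 := by
  intro h1
  have hone : (p : ℤ) ∣ 1 := by simpa using dvd_sub hX.1.2 h1
  have hle : (p : ℤ) ≤ 1 := Int.le_of_dvd one_pos hone
  have h2 := (Fact.out : p.Prime).two_le
  omega

/-- "`N` square-free", primewise: at EVERY prime `ℓ` the reduction is good or multiplicative. [folklore] -/
theorem ClassX6.good_or_mult (hX : ClassX6 W p) (ℓ : ℕ) [hℓ : Fact ℓ.Prime] : Good W ℓ ∨ Mult W ℓ :=
  hX.2.1 ℓ hℓ.out

/-- "`N` square-free", primewise: NO prime of additive reduction. [folklore] -/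
theorem ClassX6.not_addv_of_prime (hX : ClassX6 W p) (ℓ : ℕ) [Fact ℓ.Prime] : ¬ Addv W ℓ := by
  intro h
  rcases ClassX6.good_or_mult W p hX ℓ with hg | hm
  · exact h.1 hg
  · exact h.2 hm

/-- **The printed hypotheses of BSTW Thm. 1.3 / Thm. 1.5 on the leaf, packaged in the binder order of
`BurungaleSkinnerTianWan2024_thm13_OPEN` / `BurungaleSkinnerTianWan2024.thm15_pPart_OPEN`**: "`p > 2`",
"`E` semistable", "`p` supersingular", "(1.7) if `p = 3`". [cite: BurungaleSkinnerTianWan2024, Thm. 1.3 (p. 3), Thm. 1.5 (p. 4), (1.7) (p. 6) (hypotheses only; nothing asserted)] -/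
theorem ClassX6.bstw_hyps (hp : p ≠ 2) (hX : ClassX6 W p) :
    p ≠ 2 ∧ Semistable W ∧ GoodSS W p ∧ (p = 3 → W.frobeniusTrace 3 = 0) :=
  ⟨hp, hX.2.1, hX.1, BurungaleSkinnerTianWan2024.h4_of_classX6 W p hX⟩

end ClassLevel

/-! ### §2 Class-level hypotheses on the elliptic curve (image, torsion, level) -/

section ClassLevelElliptic

variable (W : WeierstrassCurve ℚ) [W.IsElliptic] [W.IsGloballyMinimal] (p : ℕ) [Fact p.Prime]

/-- "`E` semistable" in the tree's `ℤ`-spelling `W.IsSemistable ℤ`. [cite: SilvermanAEC2009, VII.5 Prop. 5.1] -/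
theorem ClassX6.isSemistable_int (hX : ClassX6 W p) : W.IsSemistable ℤ :=
  (semistable_iff_isSemistable_int W).mp hX.2.1

/-- "`E` semistable" in the `𝓞 ℚ`-spelling of Jetchev–Skinner–Wan 2017 Thm. 1.2.1 and Sprung 2024
Cor. 1.2/1.3 (`W.IsSemistable (𝓞 ℚ)`). [cite: SilvermanAEC2009, VII.5 Prop. 5.1] -/
theorem ClassX6.isSemistable_ringOfIntegers (hX : ClassX6 W p) : W.IsSemistable (𝓞 ℚ) :=
  (semistable_iff_isSemistable_ringOfIntegers W).mp hX.2.1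

/-- "`E` has square-free conductor" (Sprung 2024 Thm. 1.1; BSTW "semistable"): `Squarefree N_E`.
[cite: SilvermanAEC2009, VII.5 Prop. 5.1] -/
theorem ClassX6.squarefree_conductorNorm (hX : ClassX6 W p) : Squarefree (W.conductorNorm ℤ) :=
  (W.isSemistable_iff_squarefree_conductorNorm).mp (ClassX6.isSemistable_int W p hX)

/-- Wuthrich's image proviso "`ρ̄_{E,p}` reducible or surjective" (Prop. 21; binder `himg` of
`Typed.missingUpperBoundAt_of_wuthrich`) holds on X6 at odd `p` by the surjective branch (Serre 1972
Props. 12 and 21 i), tree `ClassX6.surj`). [cite: Serre1972, §5.4 Prop. 21 i)] [cite: Wuthrich2014, Prop. 21 (p. 400)] -/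
theorem ClassX6.not_irr_or_surj (hp : p ≠ 2) (hX : ClassX6 W p) :
    ¬ W.HasIrreducibleModPGaloisRep p ∨ W.HasSurjectiveModNGaloisRep p :=
  Or.inr (ClassX6.surj W p hp hX)

/-- X6 pairs are never anomalous Eisenstein pairs (`anom(p)` needs `E[p]` reducible). [cite: Serre1972, §1.11 Prop. 12] -/
theorem ClassX6.not_anom (hp : p ≠ 2) (hX : ClassX6 W p) : ¬ Anom W p :=
  fun h ↦ h.1 (ClassX6.irr W p hp hX)

/-- "`p ∤ #E(ℚ)_tors`", valuation form: `E[p]` irreducible at the odd supersingular prime, so `E(ℚ)`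
has no point of order `p` (Mazur: a rational `p`-torsion point spans a `Γ_ℚ`-stable line). This is why
the printed displays of Sprung 2024 Cor. 1.2 and BSTW Thm. 1.5 carry no torsion term. [cite: Mazur1977, Ch. III §5, p. 157] [cite: Sprung2024, proof of Thm. 5.3 (p. 41 L48–L49)] -/
theorem ClassX6.padicValNat_torsionOrder_eq_zero (hp : p ≠ 2) (hX : ClassX6 W p) :
    padicValNat p W.torsionOrder = 0 :=
  padicValNat_torsionOrder_eq_zero_of_irreducible W p (ClassX6.irr W p hp hX)

/-- "`p ∤ #E(ℚ)_tors`", divisibility form. [cite: Mazur1977, Ch. III §5, p. 157] -/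
theorem ClassX6.not_dvd_torsionOrder (hp : p ≠ 2) (hX : ClassX6 W p) : ¬ p ∣ W.torsionOrder := by
  intro h
  rcases padicValNat.eq_zero_iff.mp (ClassX6.padicValNat_torsionOrder_eq_zero W p hp hX) with
    h1 | h1 | h1
  · exact (Fact.out : p.Prime).one_lt.ne' h1
  · exact W.torsionOrder_pos_holds.ne' h1
  · exact h1 h

/-- **(im) on X6 at every odd `p`**: the Burungale–Castella–Skinner / Yan–Zhu big-image hypothesis
`BigIm W p` (`∃ σ ∈ G_{ℚ(μ_{p^∞})}` with `T_pE/(σ−1) ≅ ℤ_p`) follows from the full `p`-adic tower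
`ρ̄_{E,p^n}` onto for all `n` (`ClassX6.towerSurj`: Serre Prop. 21 i) + Wuthrich Lemma 20 / Serre
IV-23), by the X9 prover's `bigIm_of_hasSurjectiveModNGaloisRep_pow`. [cite: Serre1972, §5.4 Prop. 21 i)] [cite: Wuthrich2014, Lemma 20 (p. 399)] -/
theorem ClassX6.bigIm (hp : p ≠ 2) (hX : ClassX6 W p) : BigIm W p :=
  X9.bigIm_of_hasSurjectiveModNGaloisRep_pow W p (ClassX6.towerSurj W p hp hX)

end ClassLevelElliptic

/-! ### §3 The cited theorems APPLIED on the class (class-level hypotheses discharged) -/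

section Applications

variable (W : WeierstrassCurve ℚ) [W.IsElliptic] [W.IsGloballyMinimal] (p : ℕ) [Fact p.Prime]

/-- **BSTW Thm. 1.3 on X6, by name**: granted the typed Thm. 1.3 (`h13`), Kobayashi's main conjecture
holds for `(E, p, ε)` at every X6 pair with `p` odd and every sign — "semistable" = `hX.2.1`,
"supersingular `p > 2`" = `hp`, `hX.1`, "(1.7) if `p = 3`" = `h4_of_classX6`. CONDITIONAL on `h13`.
[claim: BurungaleSkinnerTianWan2024, status: under-review] [cite: Kobayashi2003, Conjecture (p. 2)] -/
theorem X6.kobayashiMainConjecture_of_thm13_OPEN (h13 : BurungaleSkinnerTianWan2024_thm13_OPEN)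
    (hp : p ≠ 2) (hX : ClassX6 W p) (ε : ℤˣ) : KobayashiMainConjecture W p ε :=
  h13 W p hp hX.2.1 hX.1 (BurungaleSkinnerTianWan2024.h4_of_classX6 W p hX) ε

/-- **BSTW Thm. 1.3 on X6 ⟹ the Eisenstein half** `KobayashiLowerDivisibility W p ε` (the typed missing
input of the leaf in rank `0`, `X6.bsdp_of_kobayashiLowerDivisibility_of_analyticRank_eq_zero`), every
sign. CONDITIONAL on `h13`. [claim: BurungaleSkinnerTianWan2024, status: under-review] [cite: Kobayashi2003, Conjecture (p. 2)] -/
theorem X6.kobayashiLowerDivisibility_of_thm13_OPEN (h13 : BurungaleSkinnerTianWan2024_thm13_OPEN)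
    (hp : p ≠ 2) (hX : ClassX6 W p) (ε : ℤˣ) : KobayashiLowerDivisibility W p ε :=
  kobayashiLowerDivisibility_of_mainConjecture (X6.kobayashiMainConjecture_of_thm13_OPEN W p h13 hp hX ε)

/-- **BSTW Thm. 1.5 on X6, by name**: granted the typed Thm. 1.5 (`h15`), at every X6 pair with `p`
odd and `ord_{s=1} L(E,s) = r ≤ 1` the printed display holds:
`L^{(r)}(E,1)/(Ω_E·Reg) = q ∈ ℚ` with `ord_p q = ord_p #Ш + ord_p ∏ c_ℓ`. CONDITIONAL on `h15`; the
step to Miller's `BSD(E,p)` is the tree theorem `X6.bsdp_of_thm15_OPEN'`.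
[claim: BurungaleSkinnerTianWan2024, status: under-review] [cite: Miller2011LMS, Def. 1.1] -/
theorem X6.printShape_of_thm15_OPEN (h15 : BurungaleSkinnerTianWan2024.thm15_pPart_OPEN)
    (hp : p ≠ 2) (hX : ClassX6 W p) (hr : W.analyticRank ≤ 1) :
    ∃ q : ℚ, W.leadingLCoeff / ((W.realPeriodRat * W.regulator : ℝ) : ℂ) = (q : ℂ) ∧
      padicValRat p q = (padicValNat p W.shaOrder : ℤ) + padicValNat p W.tamagawaProduct :=
  h15 W p hp hX.2.1 hX.1 (BurungaleSkinnerTianWan2024.h4_of_classX6 W p hX) hr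

/-- **Kobayashi 2003 Thm. 1.2 on X6, by name**: granted the fact (`h12`), for the cyclotomic
`ℤ_p`-extension `κ` with topological generator `γ` and either sign, every Pontryagin-dual datum `D` of
`Sel^ε(E/ℚ_∞)` has `X^ε` finitely generated and `Λ`-torsion — "odd good `p` with `a_p = 0`" discharged
by `hp`, `ClassX6.good`, `ClassX6.frobeniusTrace_eq_zero`. [cite: Kobayashi2003, Thm. 1.2 (p. 2)] -/
theorem X6.signedSelmerDual_finite_isTorsion (h12 : thm12_signedSelmerDual_finite_torsion)
    (hp : p ≠ 2) (hX : ClassX6 W p) {κ : ZpExtension ℚ p} {γ : Field.absoluteGaloisGroup ℚ}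
    (hκ : κ.IsCyclotomic) (hγ : κ.IsTopGenerator γ) {ε : ℤˣ} (D : SignedSelmerDualData W κ γ ε) :
    Module.Finite (IwasawaAlgebra p) D.X ∧ Module.IsTorsion (IwasawaAlgebra p) D.X :=
  h12 W p hp hX.1.1 (ClassX6.frobeniusTrace_eq_zero W p hp hX) κ γ hκ hγ ε D

/-- **Kobayashi 2003 Thm. 4.1 on X6, INTEGRAL form, by name**: granted the fact (`h41`), for the
newform `f` of `E`, the cyclotomic data `(κ, γ)` matching the cyclotomic variable, either sign, Pollack's
`L = L_p^ε(E, X)` in Kobayashi's labelling and a datum `D` of `Sel^ε(E/ℚ_∞)` with `X^ε` f.g. torsion: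
**`L_p^ε ∈ Char X^ε`** ("we can take `n = 0`") — the image hypothesis "`ρ_{E,p^∞}` surjective" is
DISCHARGED on X6 by `ClassX6.towerSurj` (Serre Prop. 21 i) + Wuthrich Lemma 20 / Serre IV-23), and
"odd good `p`, `a_p = 0`" by the class. [cite: Kobayashi2003, Thm. 4.1 (p. 8)] [cite: Serre1972, §5.4 Prop. 21 i)] [cite: Wuthrich2014, Lemma 20 (p. 399)] -/
theorem X6.signedPAdicLFunction_mem_charIdeal (h41 : thm41_signedCharIdeal_divisibility)
    (hp : p ≠ 2) (hX : ClassX6 W p) {N : ℕ} [NeZero N] {f : CuspForm (Gamma0 N) 2}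
    (hf : IsNewformOf W f) {κ : ZpExtension ℚ p} {γ : Field.absoluteGaloisGroup ℚ}
    (hκ : κ.IsCyclotomic) (hγ : κ.IsTopGenerator γ) (hγ' : IsCyclotomicVariable p γ) {ε : ℤˣ}
    {L : IwasawaAlgebra p} (hL : IsSignedPAdicLFunction f p ε L) (D : SignedSelmerDualData W κ γ ε)
    [Module.Finite (IwasawaAlgebra p) D.X] (hXt : Module.IsTorsion (IwasawaAlgebra p) D.X) :
    L ∈ D.charIdeal :=
  h41.integral hp hX.1.1 (ClassX6.frobeniusTrace_eq_zero W p hp hX) hf hκ hγ hγ' hL D hXt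
    (ClassX6.towerSurj W p hp hX)

/-- **Kobayashi Thm. 4.1 + Thm. 1.2 on X6**: the integral inclusion `L_p^ε ∈ Char X^ε` for ANY datum
`D` of `Sel^ε(E/ℚ_∞)` (torsion hypotheses from Thm. 1.2, image hypothesis from the class).
[cite: Kobayashi2003, Thm. 1.2 (p. 2) and Thm. 4.1 (p. 8)] -/
theorem X6.signedPAdicLFunction_mem_charIdeal_of_thm12 (h41 : thm41_signedCharIdeal_divisibility)
    (h12 : thm12_signedSelmerDual_finite_torsion) (hp : p ≠ 2) (hX : ClassX6 W p)
    {N : ℕ} [NeZero N] {f : CuspForm (Gamma0 N) 2} (hf : IsNewformOf W f)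
    {κ : ZpExtension ℚ p} {γ : Field.absoluteGaloisGroup ℚ}
    (hκ : κ.IsCyclotomic) (hγ : κ.IsTopGenerator γ) (hγ' : IsCyclotomicVariable p γ) {ε : ℤˣ}
    {L : IwasawaAlgebra p} (hL : IsSignedPAdicLFunction f p ε L) (D : SignedSelmerDualData W κ γ ε) :
    L ∈ D.charIdeal :=
  (h41.of_thm12 h12 hp hX.1.1 (ClassX6.frobeniusTrace_eq_zero W p hp hX) hf hκ hγ hγ' hL D).2
    (ClassX6.towerSurj W p hp hX)

/-- **Pollack 2003 on X6, by name**: granted the fact for the newform `f` of `E` at `p`, a Pollack pair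
`(L⁺, L⁻)` exists at every X6 pair with `p` odd ("good, `a_p = 0`" from the class).
[cite: Pollack2003, Thm. 5.6, Cor. 5.11 and Prop. 6.18] -/
theorem X6.exists_isPollackPair {N : ℕ} [NeZero N] {f : CuspForm (Gamma0 N) 2}
    (hP : pollack_exists_plusMinusPAdicLFunction (W := W) (f := f) (p := p)) (hp : p ≠ 2)
    (hX : ClassX6 W p) (hf : IsNewformOf W f) :
    ∃ Lplus Lminus : IwasawaAlgebra p, IsPollackPair f p Lplus Lminus :=
  Supersingular.exists_isPollackPair hP hp hf hX.1.1 (ClassX6.frobeniusTrace_eq_zero W p hp hX)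

end Applications

/-! ### §4 The leaf `ClassX6 ∧ r_an = 0`: the rank-zero upper bound and the unit-value cells -/

section Leaf

variable (W : WeierstrassCurve ℚ) [W.IsElliptic] [W.IsGloballyMinimal] (p : ℕ) [Fact p.Prime]

/-- **Wuthrich 2014 Prop. 21 on the leaf, by name**: `ord_p #Ш ≤ ord_p #Ш_an` (`MissingUpperBoundAt`)
at EVERY X6 pair with `p` odd and `r_an = 0`, no further hypothesis: "`p` odd" = `hp`, "`L(E,1) ≠ 0`"
from `h0` (modularity `hmod`), "not additive at `p`" = `ClassX6.not_hasAdditiveReduction`, "image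
reducible or surjective" = `ClassX6.not_irr_or_surj`; GZK `hGZK` for the finiteness the printed `#Ш`
presupposes. [cite: Wuthrich2014, Prop. 21 (p. 400)] [cite: Serre1972, §5.4 Prop. 21 i)] -/
theorem X6RankZero.missingUpperBoundAt_of_wuthrich (hW : sha_dvd_analyticSha)
    (hGZK : rank_eq_analyticRank_of_analyticRank_le_one) (hmod : hasEntireLFunction_rat)
    (hp : p ≠ 2) (hX : ClassX6 W p) (h0 : W.analyticRank = 0) : MissingUpperBoundAt W p :=
  Typed.missingUpperBoundAt_of_wuthrich W p hW hGZK hmod hp h0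
    (ClassX6.not_hasAdditiveReduction W p hX) (ClassX6.not_irr_or_surj W p hp hX)

/-- **Sprung 2024 Cor. 1.2 (ii) on the leaf, by name**: `ord_p #Ш ≤ ord_p #Ш_an` at EVERY X6 pair with
`p` odd and `r_an = 0` — "square-free conductor" = `ClassX6.semistable`, "supersingular `p > 2`" =
`hp`, `ClassX6.goodSS`; no image hypothesis in the printed statement. [cite: Sprung2024, Cor. 1.2 (p. 4), second sentence] -/
theorem X6RankZero.missingUpperBoundAt_of_sprungCor12
    (h : Sprung2024.cor12_padicValRat_bsd_rank_zero_le)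
    (hGZK : rank_eq_analyticRank_of_analyticRank_le_one) (hmod : hasEntireLFunction_rat)
    (hp : p ≠ 2) (hX : ClassX6 W p) (h0 : W.analyticRank = 0) : MissingUpperBoundAt W p :=
  Sprung2024.missingUpperBoundAt_of_cor12 W p h hGZK hmod hp hX.2.1 hX.1 h0

/-- **UNIT-VALUE cells close with the trivial lower bound (Wuthrich road).** On the leaf, if the
analytic order of `Ш` is a rational with `ord_p #Ш_an ≤ 0` (e.g. an exact `p`-adic unit:
`ord_p (L(E,1)/Ω · #tor² / ∏ c_ℓ) = 0`), then `0 ≤ ord_p #Ш ≤ ord_p #Ш_an ≤ 0` is the whole typed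
output and Miller's `BSD(E,p)` follows — Wuthrich Prop. 21 + GZK + modularity, nothing else.
[cite: Wuthrich2014, Prop. 21 (p. 400)] [cite: Miller2011LMS, Def. 1.1] -/
theorem X6RankZero.bsdp_of_wuthrich_of_shaAn_le (hW : sha_dvd_analyticSha)
    (hGZK : rank_eq_analyticRank_of_analyticRank_le_one) (hmod : hasEntireLFunction_rat)
    (hp : p ≠ 2) (hX : ClassX6 W p) (h0 : W.analyticRank = 0)
    (hsha : ∃ q : ℚ, shaAn W = (q : ℂ) ∧ padicValRat p q ≤ 0) : BSDp W p := by
  obtain ⟨q, hq, hle⟩ := X6RankZero.missingUpperBoundAt_of_wuthrich W p hW hGZK hmod hp hX h0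
  obtain ⟨q', hq', hle'⟩ := hsha
  have hqq : q' = q := by exact_mod_cast hq'.symm.trans hq
  subst hqq
  exact bsdp_of_missingPPartAt W p hGZK (by omega) ⟨q', hq', by omega⟩

/-- **UNIT-VALUE cells close with the trivial lower bound (Sprung road)** — the same with Sprung 2024
Cor. 1.2 (ii) supplying the upper bound. [cite: Sprung2024, Cor. 1.2 (p. 4), second sentence] [cite: Miller2011LMS, Def. 1.1] -/
theorem X6RankZero.bsdp_of_sprungCor12_of_shaAn_le (h : Sprung2024.cor12_padicValRat_bsd_rank_zero_le)
    (hGZK : rank_eq_analyticRank_of_analyticRank_le_one) (hmod : hasEntireLFunction_rat)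
    (hp : p ≠ 2) (hX : ClassX6 W p) (h0 : W.analyticRank = 0)
    (hsha : ∃ q : ℚ, shaAn W = (q : ℂ) ∧ padicValRat p q ≤ 0) : BSDp W p :=
  Sprung2024.bsdp_of_cor12_of_shaAn_le W p h hGZK hmod hp hX.2.1 hX.1 h0 hsha

/- The two halves on the leaf: with the upper bound automatic (Wuthrich Prop. 21), `BSD(E,p)` on the
leaf is EXACTLY the lower bound `MissingLowerBoundAt W p` — the tree theorem
`Typed.X6.bsdp_of_missingLowerBoundAt_of_analyticRank_eq_zero W p hW hGZK hmod hp hX h0 hlow`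
(not restated here: dedup); the converse bookkeeping follows. -/

omit [W.IsGloballyMinimal] in
/-- `BSD(E,p)` on the leaf gives back the lower bound `MissingLowerBoundAt W p` (indeed the whole typed
output, `Typed.missingPPartAt_of_bsdp`) — converse of the tree theorem
`Typed.X6.bsdp_of_missingLowerBoundAt_of_analyticRank_eq_zero`, so on the leaf `BSD(E,p)` and the
signed-IMC lower bound are interchangeable. Bookkeeping. [cite: Miller2011LMS, Def. 1.1] -/
theorem X6RankZero.missingLowerBoundAt_of_bsdp (hGZK : rank_eq_analyticRank_of_analyticRank_le_one)
    (h0 : W.analyticRank = 0) (h : BSDp W p) : MissingLowerBoundAt W p := by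
  haveI : Finite W.sha := (hGZK W (by omega)).2
  obtain ⟨q, hq, hv⟩ := missingPPartAt_of_bsdp W p h
  exact ⟨q, hq, hv.le⟩

end Leaf

end Summit.BirchSwinnertonDyer.Rank1Residual.Supersingular

end
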